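import Mathlib.MeasureTheory.Integral.Bochner.Basic
import Mathlib.MeasureTheory.Integral.Bochner.Set
import Mathlib.MeasureTheory.Integral.IntegrableOn
import Mathlib.MeasureTheory.Measure.Regular
import Mathlib.Topology.UrysohnsLemma
import Mathlib.Topology.GDelta.MetrizableSpace
import Mathlib.Topology.ContinuousMap.Bounded.Basic
import HarnessLib

/-!
# Passing `E[t_k · 1_A(X_k)]` to the limit from joint convergence in law of `(X_k, t_k)`

Topic `Literature/Probability/Distributions`; a glue lemma of weak-convergence bookkeeping,
written for the limit passage of Campbell-measure identities of lattice models (route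
`Summits/CriticalPhenomena/CardyFormulaZ2/Theses/CardyMeckeFlip`, crux `FlipErgodicityZ2`, node (D)
of the census of the stub "the flip identity passes to the limit"), but model-free.

**Setting.**  Random elements `X_k : Ω → E` of a pseudo-metrizable Borel space and non-negative
random reals `t_k : Ω → ℝ` on a finite measure space `(Ω, P)`; a finite Borel measure `μ` on `E`
and a measurable non-negative `tlim : E → ℝ`; the pairs `(X_k, t_k)` converge "in law" to
`(S, tlim S)`, `S ∼ μ`, in the functional form
`∫ F(X_k, t_k) dP → ∫ F(S, tlim S) dμ(S)` for every bounded continuous `F : E × ℝ → ℝ`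
(this is how `IsZ2PivotalKernelLimit` of `Literature/Probability/Percolation/Z2PivotalMeasure.lean`
phrases the joint convergence of a configuration and the integral of a test function against a
random measure).

**Results.**
* `abs_integral_mul_sub_integral_min_mul_le` — the truncation estimate
  `|∫ s·B − ∫ min(s,K)·B| ≤ (∫ s²)/K` for `s ≥ 0`, `B ∈ [0,1]` (from `s - min s K ≤ s²/K`);
* `lintegral_sq_le_of_tendsto_pair`, `integrable_sq_of_tendsto_pair` — Fatou-type inheritance of
  the second-moment bound: `sup_k E[t_k²] ≤ C` implies `∫ tlim² dμ ≤ C` (test against the bounded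
  continuous `(min s n)²` and let `n → ∞` by monotone convergence);
* (sibling file `JointLawTruncatedLimitGlue.lean`) `tendsto_integral_min_mul_of_tendsto_pair` —
  the portmanteau sandwich for the TRUNCATED weights on a `μ`-continuity set — and
  `tendsto_integral_mul_indicator_of_tendsto_pair` — **the glue**
  `E[t_k 1_A(X_k)] → ∫ tlim · 1_A dμ`.

No named fact; Mathlib only.

## References

* P. Billingsley, *Convergence of Probability Measures*, 2nd ed. (1999), Thm. 2.1 (portmanteau)
  and Thm. 3.5 (uniform integrability and convergence of moments) — the two facts combined here.
-/

noncomputable section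

open Set Filter
open _root_.MeasureTheory _root_.Topology
open scoped ENNReal

namespace Literature.Probability.Distributions

/-! ### Elementary inequalities for the truncation `t ↦ min t K` -/

/-- For `t ≥ 0` and `K > 0`, the truncation error is controlled by the second moment:
`t - min t K ≤ t² / K`. [folklore] -/
theorem sub_min_le_sq_div {t K : ℝ} (ht : 0 ≤ t) (hK : 0 < K) : t - min t K ≤ t ^ 2 / K := by
  rcases le_or_gt t K with h | h
  · rw [min_eq_left h, sub_self]
    positivity
  · rw [min_eq_right h.le, le_div_iff₀ hK]
    nlinarith

/-- `0 ≤ t - min t K`. [folklore] -/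
theorem sub_min_nonneg (t K : ℝ) : 0 ≤ t - min t K := sub_nonneg.2 (min_le_left t K)

/-- A product `u · v` with `0 ≤ u ≤ K` and `v ∈ [0, 1]`, both measurable, is integrable for a
finite measure. [folklore] -/
theorem integrable_mul_of_le_of_mem_Icc {α : Type*} [MeasurableSpace α] {ν : Measure α}
    [IsFiniteMeasure ν] {u v : α → ℝ} (hu : Measurable u) (hv : Measurable v) {K : ℝ}
    (hu0 : ∀ x, 0 ≤ u x) (huK : ∀ x, u x ≤ K) (hv01 : ∀ x, v x ∈ Icc (0 : ℝ) 1) :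
    Integrable (fun x => u x * v x) ν := by
  refine Integrable.of_bound (hu.mul hv).aestronglyMeasurable K
    (Eventually.of_forall fun x => ?_)
  rw [Real.norm_eq_abs, abs_of_nonneg (mul_nonneg (hu0 x) (hv01 x).1)]
  calc u x * v x ≤ K * 1 := mul_le_mul (huK x) (hv01 x).2 (hv01 x).1 ((hu0 x).trans (huK x))
    _ = K := mul_one K

/-- **Truncation estimate.**  For `s ≥ 0` integrable with integrable square and `B ∈ [0, 1]`
measurable, `|∫ s·B − ∫ min(s,K)·B| ≤ (∫ s²)/K`. [folklore] -/
theorem abs_integral_mul_sub_integral_min_mul_le {α : Type*} [MeasurableSpace α] (ν : Measure α)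
    {s B : α → ℝ} (hs : Measurable s) (hB : Measurable B) (hs0 : ∀ x, 0 ≤ s x)
    (hB01 : ∀ x, B x ∈ Icc (0 : ℝ) 1) (hsi : Integrable s ν)
    (hs2 : Integrable (fun x => s x ^ 2) ν) {K : ℝ} (hK : 0 < K) :
    |∫ x, s x * B x ∂ν - ∫ x, min (s x) K * B x ∂ν| ≤ (∫ x, s x ^ 2 ∂ν) / K := by
  have hi1 : Integrable (fun x => s x * B x) ν := by
    refine hsi.mono' (hs.mul hB).aestronglyMeasurable (Eventually.of_forall fun x => ?_)
    rw [Real.norm_eq_abs, abs_of_nonneg (mul_nonneg (hs0 x) (hB01 x).1)]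
    calc s x * B x ≤ s x * 1 := mul_le_mul_of_nonneg_left (hB01 x).2 (hs0 x)
      _ = s x := mul_one _
  have hi2 : Integrable (fun x => min (s x) K * B x) ν := by
    refine hsi.mono' ((hs.min measurable_const).mul hB).aestronglyMeasurable
      (Eventually.of_forall fun x => ?_)
    rw [Real.norm_eq_abs, abs_of_nonneg (mul_nonneg (le_min (hs0 x) hK.le) (hB01 x).1)]
    calc min (s x) K * B x ≤ s x * 1 :=
        mul_le_mul (min_le_left _ _) (hB01 x).2 (hB01 x).1 (hs0 x)
      _ = s x := mul_one _
  rw [← integral_sub hi1 hi2]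
  have hpt : ∀ x, s x * B x - min (s x) K * B x ≤ s x ^ 2 / K := fun x => by
    rw [← sub_mul]
    calc (s x - min (s x) K) * B x ≤ (s x - min (s x) K) * 1 :=
        mul_le_mul_of_nonneg_left (hB01 x).2 (sub_min_nonneg _ _)
      _ ≤ s x ^ 2 / K := by rw [mul_one]; exact sub_min_le_sq_div (hs0 x) hK
  have hpt0 : ∀ x, 0 ≤ s x * B x - min (s x) K * B x := fun x => by
    rw [← sub_mul]
    exact mul_nonneg (sub_min_nonneg _ _) (hB01 x).1
  rw [abs_of_nonneg (integral_nonneg hpt0), ← integral_div]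
  exact integral_mono (hi1.sub hi2) (hs2.div_const K) hpt

/-- The bounded continuous test function `(S, s) ↦ g S * max 0 (min s K)` built from a bounded
continuous `g` with values in `[0, 1]` (its values lie in `[0, K]`). [folklore] -/
theorem exists_bcf_mul_clamp {E : Type*} [TopologicalSpace E] (g : BoundedContinuousFunction E ℝ)
    (hg : ∀ S, g S ∈ Icc (0 : ℝ) 1) {K : ℝ} (hK : 0 < K) :
    ∃ F : BoundedContinuousFunction (E × ℝ) ℝ, ∀ S s, F (S, s) = g S * max 0 (min s K) := by
  have hval : ∀ r : E × ℝ, g r.1 * max 0 (min r.2 K) ∈ Icc (0 : ℝ) K := fun r => by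
    have h1 := hg r.1
    have h2 : max 0 (min r.2 K) ∈ Icc (0 : ℝ) K :=
      ⟨le_max_left _ _, max_le hK.le (min_le_right _ _)⟩
    exact ⟨mul_nonneg h1.1 h2.1, by nlinarith [h1.1, h1.2, h2.1, h2.2]⟩
  refine ⟨BoundedContinuousFunction.mkOfBound
    ⟨fun p : E × ℝ => g p.1 * max 0 (min p.2 K), ?_⟩ K ?_, fun S s => rfl⟩
  · exact (g.continuous.comp continuous_fst).mul
      (continuous_const.max (continuous_snd.min continuous_const))
  · intro p q
    have hp := hval p
    have hq := hval q
    simp only [ContinuousMap.coe_mk, Real.dist_eq]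
    rw [abs_sub_le_iff]
    constructor <;> linarith [hp.1, hp.2, hq.1, hq.2]

/-- An indicator of `1` takes values in `[0, 1]`. [folklore] -/
theorem indicator_one_mem_Icc {α : Type*} (s : Set α) (x : α) :
    s.indicator (1 : α → ℝ) x ∈ Icc (0 : ℝ) 1 :=
  ⟨indicator_nonneg (fun _ _ => zero_le_one) x, indicator_le_self' (fun _ _ => zero_le_one) x⟩

/-! ### The second-moment bound passes to the limit -/

section Limit

variable {Ω E : Type*} [MeasurableSpace Ω] {P : Measure Ω}
  [TopologicalSpace E] [MeasurableSpace E] {μ : Measure E}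

/-- **Inheritance of the second-moment bound.**  If `∫ F(X_k, t_k) dP → ∫ F(S, tlim S) dμ` for
every bounded continuous `F`, the `t_k` are non-negative with `E[t_k²] ≤ C`, and `tlim ≥ 0` is
measurable, then `∫⁻ tlim² dμ ≤ C` (Fatou through the truncations `(min s n)²`). [folklore] -/
theorem lintegral_sq_le_of_tendsto_pair [OpensMeasurableSpace E] [IsFiniteMeasure μ]
    {X : ℕ → Ω → E} {t : ℕ → Ω → ℝ} {tlim : E → ℝ}
    (htlim : Measurable tlim) (ht0 : ∀ k ω, 0 ≤ t k ω) (htlim0 : ∀ S, 0 ≤ tlim S)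
    (hconv : ∀ F : BoundedContinuousFunction (E × ℝ) ℝ,
      Tendsto (fun k => ∫ ω, F (X k ω, t k ω) ∂P) atTop (𝓝 (∫ S, F (S, tlim S) ∂μ)))
    (hint : ∀ k, Integrable (fun ω => t k ω ^ 2) P) {C : ℝ} (hC : ∀ k, ∫ ω, t k ω ^ 2 ∂P ≤ C) :
    ∫⁻ S, ENNReal.ofReal (tlim S ^ 2) ∂μ ≤ ENNReal.ofReal C := by
  -- the truncated squares `(min tlim (n+1))²` increase to `tlim²`
  have hmono : Monotone fun (n : ℕ) (S : E) => ENNReal.ofReal (min (tlim S) (n + 1 : ℝ) ^ 2) := by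
    intro n m hnm S
    apply ENNReal.ofReal_le_ofReal
    have h0 : 0 ≤ min (tlim S) (n + 1 : ℝ) := le_min (htlim0 S) (by positivity)
    have hle : min (tlim S) (n + 1 : ℝ) ≤ min (tlim S) (m + 1 : ℝ) :=
      min_le_min_left _ (by exact_mod_cast Nat.succ_le_succ hnm)
    exact pow_le_pow_left₀ h0 hle 2
  have hsup : (fun S => ENNReal.ofReal (tlim S ^ 2)) =
      fun S => ⨆ n : ℕ, ENNReal.ofReal (min (tlim S) (n + 1 : ℝ) ^ 2) := by
    funext S
    apply le_antisymm
    · obtain ⟨n, hn⟩ := exists_nat_ge (tlim S)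
      refine le_iSup_of_le n (le_of_eq ?_)
      rw [min_eq_left (hn.trans (by linarith))]
    · refine iSup_le fun n => ENNReal.ofReal_le_ofReal ?_
      exact pow_le_pow_left₀ (le_min (htlim0 S) (by positivity)) (min_le_left _ _) 2
  have hmeasn : ∀ n : ℕ, Measurable fun S => ENNReal.ofReal (min (tlim S) (n + 1 : ℝ) ^ 2) :=
    fun n => ((htlim.min measurable_const).pow_const 2).ennreal_ofReal
  rw [hsup, lintegral_iSup hmeasn hmono]
  refine iSup_le fun n => ?_
  -- each truncated second moment of the limit is a limit of truncated second moments `≤ C`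
  set K : ℝ := n + 1 with hKdef
  have hK : 0 < K := by positivity
  obtain ⟨F, hF⟩ := exists_bcf_mul_clamp (1 : BoundedContinuousFunction E ℝ)
    (fun S => by simp) hK
  have hFF : ∀ S s, (F * F) (S, s) = (max 0 (min s K)) ^ 2 := fun S s => by
    rw [BoundedContinuousFunction.coe_mul, Pi.mul_apply, hF, BoundedContinuousFunction.coe_one,
      Pi.one_apply, one_mul, sq]
  have hlhs : ∀ k, ∫ ω, (F * F) (X k ω, t k ω) ∂P ≤ C := fun k => by
    refine le_trans (integral_mono_of_nonneg (Eventually.of_forall fun ω => ?_) (hint k)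
      (Eventually.of_forall fun ω => ?_)) (hC k)
    · show (0 : ℝ) ≤ (F * F) (X k ω, t k ω)
      rw [hFF]; positivity
    · show (F * F) (X k ω, t k ω) ≤ t k ω ^ 2
      rw [hFF, max_eq_right (le_min (ht0 k ω) hK.le)]
      exact pow_le_pow_left₀ (le_min (ht0 k ω) hK.le) (min_le_left _ _) 2
  have hrhs : ∫ S, (F * F) (S, tlim S) ∂μ ≤ C := le_of_tendsto' (hconv (F * F)) hlhs
  have hrhs' : ∫ S, min (tlim S) K ^ 2 ∂μ ≤ C := by
    have heq : (fun S => (F * F) (S, tlim S)) = fun S => min (tlim S) K ^ 2 := by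
      funext S; rw [hFF, max_eq_right (le_min (htlim0 S) hK.le)]
    rwa [heq] at hrhs
  -- convert the Bochner bound into a lintegral bound (the integrand is bounded, hence integrable)
  have hmeas : Measurable fun S => min (tlim S) K ^ 2 := (htlim.min measurable_const).pow_const 2
  have hbdd : ∀ S, ‖min (tlim S) K ^ 2‖ ≤ K ^ 2 := fun S => by
    rw [Real.norm_eq_abs, abs_of_nonneg (sq_nonneg _)]
    exact pow_le_pow_left₀ (le_min (htlim0 S) hK.le) (min_le_right _ _) 2
  have hintlim : Integrable (fun S => min (tlim S) K ^ 2) μ :=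
    Integrable.of_bound hmeas.aestronglyMeasurable (K ^ 2) (Eventually.of_forall hbdd)
  rw [← ofReal_integral_eq_lintegral_ofReal hintlim (Eventually.of_forall fun S => sq_nonneg _)]
  exact ENNReal.ofReal_le_ofReal hrhs'

/-- Under the hypotheses of `lintegral_sq_le_of_tendsto_pair`, `tlim²` is `μ`-integrable with
`∫ tlim² dμ ≤ C`, and `tlim` itself is integrable. [folklore] -/
theorem integrable_sq_of_tendsto_pair [OpensMeasurableSpace E] [IsFiniteMeasure μ]
    {X : ℕ → Ω → E} {t : ℕ → Ω → ℝ} {tlim : E → ℝ}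
    (htlim : Measurable tlim) (ht0 : ∀ k ω, 0 ≤ t k ω) (htlim0 : ∀ S, 0 ≤ tlim S)
    (hconv : ∀ F : BoundedContinuousFunction (E × ℝ) ℝ,
      Tendsto (fun k => ∫ ω, F (X k ω, t k ω) ∂P) atTop (𝓝 (∫ S, F (S, tlim S) ∂μ)))
    (hint : ∀ k, Integrable (fun ω => t k ω ^ 2) P) {C : ℝ} (hC : ∀ k, ∫ ω, t k ω ^ 2 ∂P ≤ C) :
    Integrable (fun S => tlim S ^ 2) μ ∧ ∫ S, tlim S ^ 2 ∂μ ≤ C ∧ Integrable tlim μ := by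
  have hC0 : 0 ≤ C := le_trans (integral_nonneg fun ω => sq_nonneg _) (hC 0)
  have hlin := lintegral_sq_le_of_tendsto_pair htlim ht0 htlim0 hconv hint hC
  have hmeas : Measurable fun S => tlim S ^ 2 := htlim.pow_const 2
  have hfin : HasFiniteIntegral (fun S => tlim S ^ 2) μ := by
    rw [hasFiniteIntegral_iff_ofReal (Eventually.of_forall fun S => sq_nonneg _)]
    exact hlin.trans_lt ENNReal.ofReal_lt_top
  have hsq : Integrable (fun S => tlim S ^ 2) μ := ⟨hmeas.aestronglyMeasurable, hfin⟩
  refine ⟨hsq, ?_, ?_⟩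
  · rw [integral_eq_lintegral_of_nonneg_ae (Eventually.of_forall fun S => sq_nonneg _)
      hmeas.aestronglyMeasurable]
    exact ENNReal.toReal_le_of_le_ofReal hC0 hlin
  · -- `|tlim| ≤ 1 + tlim²`
    refine Integrable.mono' (g := fun S => 1 + tlim S ^ 2) ((integrable_const (1 : ℝ)).add hsq)
      htlim.aestronglyMeasurable (Eventually.of_forall fun S => ?_)
    rw [Real.norm_eq_abs, abs_of_nonneg (htlim0 S)]
    nlinarith [htlim0 S, sq_nonneg (tlim S - 1)]

end Limit

end Literature.Probability.Distributions

end
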